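import Mathlib
import Summits.ValiantsHypothesis.ValiantsHypothesis.Theorems.GrenetZeonHessianRankCodimTwoLatinFrobeniusBlock
import Summits.ValiantsHypothesis.ValiantsHypothesis.Theorems.GrenetZeonHessianRankCodimTwoBorderFrobenius
import HarnessLib

/-!
# Crux `GrenetZeon.HessianRankCodimTwo` (stmt-ValiantsHypothesis-8061), line `good_plane`, ALL large `n`:
# the Frobenius congruences of the bordered Latin plane, II — `Φ ≡ F^p w^r` and `Ψ_{IJ} ≡ P_{J-I}^p · bordLow`

Seat val-width-8061-p1 g2 (memo `Cruxes/HessianRankCodimTwo/BorderedLatinAllN.md`, §2).  Over a commutative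
ring `R` of prime characteristic `p` with `r < p` (and `p > 2` for the block congruence):

* `bordPhi_eq` — `bordPhi R p r = cubicF R ^ p * (bordEnt R none none) ^ r`: modulo `p` the permanent table
  of the bordered Latin point is `F(a)^p · w(a)^r`;
* `bordPsi_eq` — `bordPsi R p r I J = quadP R (J - I) ^ p * bordLow R p r I J`: modulo `p` the core block table
  `(I, J)` is `P_{J-I}(a)^p` times the low-digit sum (`= a_d^{p-2-r}(a_d w - u_I v_J)^{r-1}(a_d w - (r+1)u_I v_J)`
  by `…BorderLowSum.lean`).

Proof: Frobenius on the core row forms (`bordRowForm_pow_prime`), expansion into monomials in `y^p`, and the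
digit lemmas of `…BorderFrobenius.lean` (the exponent inequality pins the Frobenius part); the surviving low
coefficient is `coeff_bordRowForm_pow_mul_pow`, the surviving Frobenius weights sum to `F^p` (Theorem P's
`sum_distinct_prod_X_sub_eq_cubicF`) resp. `(a_d² + a_{d+1}a_{d+2})^p`.  VP ≠ VNP is not moved by anything here.
-/

noncomputable section

open MvPolynomial Finset

-- single-conjunct layout `Summits/ValiantsHypothesis/ValiantsHypothesis`: duplicated namespace by design
set_option linter.dupNamespace false

namespace Summit.ValiantsHypothesis.ValiantsHypothesis.Theorems.GrenetZeonHessianRankCodimTwo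

variable {R : Type*} [CommRing R]

/-- `[y_J^k] ℓ_I^k = L_{IJ}^k`. [folklore] -/
theorem coeff_single_bordRowForm_pow (I J : Option (Fin 3)) (k : ℕ) :
    coeff (Finsupp.single J k) (bordRowForm R I ^ k) = bordEnt R I J ^ k := by
  classical
  obtain ⟨B, hB⟩ : ∃ B : Option (Fin 3), J ≠ B := by
    rcases J with _ | J
    · exact ⟨some 0, Option.some_ne_none 0 |>.symm⟩
    · exact ⟨none, Option.some_ne_none J⟩
  have h := coeff_pow_mul_pow_two_vars hB (bordEnt R I) (bordEnt R I) k 0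
  rw [Finsupp.single_zero, add_zero, pow_zero, mul_one] at h
  rw [bordRowForm_def, h, Finset.sum_range_one]
  simp

section Frobenius

variable (p : ℕ) [hp : Fact p.Prime] [CharP R p]

/-- Frobenius on a row form: `ℓ_I(y)^p = Σ_J L_{IJ}^p y_J^p`. [folklore] -/
theorem bordRowForm_pow_prime (I : Option (Fin 3)) :
    bordRowForm R I ^ p =
      ∑ J : Option (Fin 3), C (bordEnt R I J ^ p) * (X J : MvPolynomial (Option (Fin 3)) (MvPolynomial (Fin 3) R)) ^ p := by
  rw [bordRowForm_def, sum_pow_char]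
  simp_rw [mul_pow, ← map_pow]

/-- The product of the three Frobenius core row forms as a sum of monomials in `y^p`. [folklore] -/
theorem prod_bordRowForm_pow_prime :
    (∏ I : Fin 3, bordRowForm R (some I) ^ p) =
      ∑ g : Fin 3 → Option (Fin 3), C (∏ I, bordEnt R (some I) (g I) ^ p) *
        monomial (∑ I, Finsupp.single (g I) p) 1 := by
  simp_rw [bordRowForm_pow_prime]
  exact prod_sum_C_mul_X_pow (fun I J => bordEnt R (some I) J ^ p) (fun _ => p)

/-- Product of two Frobenius row forms as a double sum of monomials in `y^p`. [folklore] -/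
theorem bordRowForm_pow_prime_mul (I₁ I₂ : Option (Fin 3)) :
    bordRowForm R I₁ ^ p * bordRowForm R I₂ ^ p =
      ∑ J₁ : Option (Fin 3), ∑ J₂ : Option (Fin 3),
        monomial (Finsupp.single J₁ p + Finsupp.single J₂ p) (bordEnt R I₁ J₁ ^ p * bordEnt R I₂ J₂ ^ p) := by
  rw [bordRowForm_pow_prime, bordRowForm_pow_prime, Finset.sum_mul_sum]
  refine Finset.sum_congr rfl fun J₁ _ => Finset.sum_congr rfl fun J₂ _ => ?_
  rw [C_mul_X_pow_eq_monomial, C_mul_X_pow_eq_monomial, monomial_mul]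

variable {p}

/-- **`Φ ≡ F^p · w^r` (mod `p`).** [folklore] -/
theorem bordPhi_eq {r : ℕ} (hr : r < p) :
    bordPhi R p r = cubicF R ^ p * bordEnt R none none ^ r := by
  classical
  have hp0 : 0 < p := hp.out.pos
  rw [bordPhi, prod_bordRowForm_pow_prime p, Finset.sum_mul, coeff_sum]
  -- each Frobenius pattern `g` contributes iff it is a bijection onto the core
  have hterm : ∀ g : Fin 3 → Option (Fin 3),
      coeff (bordNuPer p r) (C (∏ I, bordEnt R (some I) (g I) ^ p) * monomial (∑ I, Finsupp.single (g I) p) 1 *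
          bordRowForm R none ^ r) =
        if (∑ I, Finsupp.single (g I) p) ≤ bordNuPer p r then
          (∏ I, bordEnt R (some I) (g I) ^ p) * bordEnt R none none ^ r else 0 := by
    intro g
    rw [mul_assoc, coeff_C_mul, coeff_monomial_mul']
    split_ifs with hle
    · obtain ⟨σ, hg, -, hdiff⟩ := exists_of_sum_single_le_bordNuPer hp0 hr g hle
      rw [hdiff, coeff_single_bordRowForm_pow, one_mul]
    · rw [mul_zero]
  simp_rw [hterm]
  -- reindex by `σ : Fin 3 → Fin 3`
  set φ : (Fin 3 → Fin 3) → (Fin 3 → Option (Fin 3)) := fun σ I => some (σ I) with hφ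
  have hφinj : Function.Injective φ := by
    intro σ σ' h
    funext I
    have := congr_fun h I
    simpa [hφ] using this
  have hvanish : ∀ g ∈ (Finset.univ : Finset (Fin 3 → Option (Fin 3))), g ∉ Finset.univ.image φ →
      (if (∑ I, Finsupp.single (g I) p) ≤ bordNuPer p r then
          (∏ I, bordEnt R (some I) (g I) ^ p) * bordEnt R none none ^ r else 0) = 0 := by
    intro g _ hg
    rw [if_neg]
    intro hle
    obtain ⟨σ, hgσ, -, -⟩ := exists_of_sum_single_le_bordNuPer hp0 hr g hle
    exact hg (Finset.mem_image.mpr ⟨σ, Finset.mem_univ _, hgσ.symm⟩)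
  rw [← Finset.sum_subset (Finset.subset_univ (Finset.univ.image φ)) hvanish,
    Finset.sum_image fun σ _ σ' _ h => hφinj h]
  -- now the sum over `σ`, non-zero iff `σ` has distinct values
  have hσ : ∀ σ : Fin 3 → Fin 3,
      (if (∑ I, Finsupp.single (φ σ I) p) ≤ bordNuPer p r then
          (∏ I, bordEnt R (some I) (φ σ I) ^ p) * bordEnt R none none ^ r else 0) =
        if (∑ I, Finsupp.single (σ I) 1) = ∑ K : Fin 3, Finsupp.single K 1 then
          (∏ I, (X (σ I - I) : MvPolynomial (Fin 3) R)) ^ p * bordEnt R none none ^ r else 0 := by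
    intro σ
    simp only [hφ, bordEnt_some_some, Finset.prod_pow]
    by_cases hd : σ 0 ≠ σ 1 ∧ σ 0 ≠ σ 2 ∧ σ 1 ≠ σ 2
    · rw [if_pos, if_pos ((sum_single_one_eq_iff σ).mpr hd)]
      have hbij : Function.Bijective σ := by
        refine Finite.injective_iff_bijective.mp fun a b hab => ?_
        fin_cases a <;> fin_cases b
        all_goals first | rfl | (exfalso; simp only at hab; first
          | exact hd.1 hab | exact hd.1 hab.symm | exact hd.2.1 hab | exact hd.2.1 hab.symm
          | exact hd.2.2 hab | exact hd.2.2 hab.symm)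
      rw [show (∑ I, Finsupp.single (some (σ I)) p) = ∑ K : Fin 3, Finsupp.single (some K) p from
        Fintype.sum_bijective σ hbij _ _ fun _ => rfl, bordNuPer]
      exact le_self_add
    · rw [if_neg, if_neg (fun h => hd ((sum_single_one_eq_iff σ).mp h))]
      intro hle
      obtain ⟨σ', hg, hd', -⟩ := exists_of_sum_single_le_bordNuPer hp0 hr (fun I => some (σ I)) hle
      have : σ = σ' := funext fun I => by simpa using congr_fun hg I
      subst this
      exact hd hd'
  simp_rw [hσ]
  rw [← Finset.sum_filter, ← Finset.sum_mul, ← sum_pow_char, sum_distinct_prod_X_sub_eq_cubicF]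

/-- **`Ψ_{IJ} ≡ P_{J-I}^p · bordLow` (mod `p`).** [folklore] -/
theorem bordPsi_eq (hp2 : 2 < p) {r : ℕ} (hr : r < p) (I J : Fin 3) :
    bordPsi R p r I J = quadP R (J - I) ^ p * bordLow R p r I J := by
  classical
  rw [bordPsi, bordRowForm_pow_prime_mul p,
    show ∀ (Q M N : MvPolynomial (Option (Fin 3)) (MvPolynomial (Fin 3) R)), Q * M * N = (Q * N) * M from
      fun Q M N => by ring,
    Finset.mul_sum, coeff_sum]
  simp_rw [Finset.mul_sum, coeff_sum, coeff_mul_monomial', le_bordNuBlock_iff hp2 hr J]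
  -- evaluate the double sum over `Option (Fin 3)`: only `(J+1, J+2)` and `(J+2, J+1)` survive
  rw [Fintype.sum_option]
  simp only [reduceCtorEq, false_and, or_self, if_false, Finset.sum_const_zero, zero_add]
  simp_rw [Fintype.sum_option]
  simp only [reduceCtorEq, and_false, or_self, if_false, zero_add, Option.some.injEq]
  rw [sum_sum_eq_sum_sum_add J]
  simp only [add_right_inj, Fin.sum_univ_three, Fin.isValue, Fin.reduceEq, and_true, and_false,
    or_self, or_false, false_or, if_true, if_false, zero_add, add_zero]
  rw [bordNuBlock_sub J, show Finsupp.single (some (J + 2)) p + Finsupp.single (some (J + 1)) p =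
      Finsupp.single (some (J + 1)) p + Finsupp.single (some (J + 2)) p from add_comm _ _, bordNuBlock_sub J,
    coeff_bordRowForm_pow_mul_pow, bordEnt_some_some, bordEnt_some_some, bordEnt_some_some, bordEnt_some_some]
  have e1 : J + 1 - (I + 1) = J - I := (by decide : ∀ a b : Fin 3, a + 1 - (b + 1) = a - b) J I
  have e2 : J + 2 - (I + 2) = J - I := (by decide : ∀ a b : Fin 3, a + 2 - (b + 2) = a - b) J I
  have e3 : J + 2 - (I + 1) = J - I + 1 := (by decide : ∀ a b : Fin 3, a + 2 - (b + 1) = a - b + 1) J I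
  have e4 : J + 1 - (I + 2) = J - I + 2 := (by decide : ∀ a b : Fin 3, a + 1 - (b + 2) = a - b + 2) J I
  rw [e1, e2, e3, e4, quadP, add_pow_char, mul_pow, ← pow_mul]
  ring

end Frobenius

end Summit.ValiantsHypothesis.ValiantsHypothesis.Theorems.GrenetZeonHessianRankCodimTwo
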